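import Summits.HodgeConjecture.HodgeConjecture.Theses.HeckePrymWeil
import Summits.HodgeConjecture.HodgeConjecture.Theorems.HeckePrymWeilHeckePrymAnchorsOfStubs
import Summits.HodgeConjecture.HodgeConjecture.Theorems.HeckePrymWeilHeckePrymAnchorsUpgrade
import Summits.HodgeConjecture.HodgeConjecture.Theorems.HeckePrymWeilHeckePrymAnchorsRationalAlongSection
import Summits.HodgeConjecture.HodgeConjecture.Theorems.HeckePrymWeilHeckePrymAnchorsGlobalClassOfLeray
import Summits.HodgeConjecture.HodgeConjecture.Theorems.HeckePrymWeilHeckePrymAnchorsOfDeligneWeilFamilyDecl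
import Literature.AlgebraicGeometry.HodgeTheory.AlgebraicClassesCupAbelianVariety
import Literature.AlgebraicGeometry.HodgeTheory.WeilTypePeriodPoint
import Literature.AlgebraicGeometry.HodgeTheory.WeilFamilyKAction
import Literature.AlgebraicGeometry.HodgeTheory.WeilFamilyBalanced
import Literature.AlgebraicGeometry.HodgeTheory.InvariantClassesFromTotalSpaceHolds
import Literature.AlgebraicGeometry.HodgeTheory.SemiregularVariationalHodgeFull
import Literature.AlgebraicGeometry.HodgeTheory.StandardChernCharacterBetti
import Literature.AlgebraicGeometry.HodgeTheory.LefschetzOneOneHolds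
import Literature.AlgebraicGeometry.HodgeTheory.HodgeTypeExteriorProduct
import Literature.AlgebraicGeometry.HodgeTheory.HodgeTypeConjugation
import Literature.AlgebraicGeometry.HodgeTheory.FermatHypersurfaceReduction
import Literature.AlgebraicGeometry.HodgeTheory.AlgebraicClassesHodgeTypeHolds
import Literature.AlgebraicGeometry.HodgeTheory.HolomorphicBundleChernCharacterProjectiveSpace
import Literature.AlgebraicGeometry.HodgeTheory.ComplexConjugationHolds
import Literature.AlgebraicGeometry.HodgeTheory.FubiniStudyClassRational
import Literature.AlgebraicGeometry.Motives.VarietiesGeometricallyIntegralProofs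
import HarnessLib

/-!
# `WeilTenfoldsSqrtMinus11` by the Perry route, v3 — PART 1: the Weil-section package WITH the total-space `K`-action
# (item stmt-HodgeConjecture-1262, route HeckePrymWeil, line `quaternionic-norm-anchors`, skeleton v3, lead c3, 2026-08-17)

One proved ingredient of the v3 composition `stub_perryRouteCompositionPol` (PART 2,
`Theorems/HeckePrymWeilWeilTenfoldsSqrtMinus11TensorAnchorPerryPol`), registered on the item by `stub-add`:
`hodgeWeilSectionG_of_globalAction` — Deligne's abelian scheme with `K`-action (`deligne1982_weilFamily_globalAction`,
a consequence of the route item `DeligneWeilFamily` by the landed `deligneWeilFamilyDecl_iff_kAction` +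
`deligne1982_weilFamily_globalAction_of_kAction`) gives the fibrewise-Hodge flat Weil section EXACTLY as the
Literature theorem `deligne1982_weilFamily_hodgeWeilSection_of_globalAction` does, but with the total-space `√-p`,
`g : 𝒳 ⟶ 𝒳` over `S`, and its intertwining clauses at every fibre, at `s₁` and at the anchor `s₀` KEPT — PART 2
builds the GLOBAL `K`-symmetrised polarization class `p·Θ + g^*Θ` of the family from them (the polarised bet
`stub_tensorAnchorObjectPol` is typed against the `K`-symmetrised hyperplane class of the anchor, as the route types
polarizations in `IsHyperbolicWeilType`).  Proof verbatim the Literature theorem's (transport along paths from `s₁`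
preserves the cohomological Weil planes; the charts identify them with the Weil planes of balanced abelian
`2k`-folds).  Nothing is asserted; no definition; no `sorry`.
-/

noncomputable section

-- single-problem summit (Problem = Summit): the mandated namespace repeats `HodgeConjecture`.
set_option linter.dupNamespace false

open CategoryTheory AlgebraicGeometry Limits MonoidalCategory CartesianMonoidalCategory
open Literature.AlgebraicGeometry Literature.AlgebraicGeometry.Motives
  Literature.AlgebraicGeometry.HodgeTheory
open Literature.AlgebraicTopology.SingularHomology
open Summit.HodgeConjecture.HodgeConjecture.Theorems.HeckePrymWeilLine
  (stub_upgrade stub_rationalAlongSection gcs_section_eq_of_eq owf_isoTransport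
    stub_globalClassOfSection_of_leray deligneWeilFamilyDecl_iff_kAction)

namespace Summit.HodgeConjecture.HodgeConjecture.Theorems.WeilTenfoldsSqrtMinus11.TensorAnchorPerryPol

/-! ## The fibrewise-Hodge flat Weil section WITH the total-space `√-p` (package, proved) -/

/-- **Deligne's abelian scheme with `K`-action gives the fibrewise-Hodge flat Weil section, the action being
KEPT** — verbatim `deligne1982_weilFamily_hodgeWeilSection_of_globalAction` (transport along paths from `s₁`
preserves the cohomological Weil planes of the fibres, which the charts identify with the Weil planes of
balanced abelian `2k`-folds), except that the conclusion retains `g : 𝒳 ⟶ 𝒳` over `S` with its intertwining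
clauses at every fibre, at `s₁` and at the anchor `s₀` (the consumer builds the global `K`-symmetrised
polarization class `p·Θ + g^*Θ` from it). [cite: Deligne1982HodgeCycles, proof of Thm. 4.8 (pp. 48–51) with Prop. 4.4]
[cite: VoisinHodgeII2003, §3.1.2] -/
theorem hodgeWeilSectionG_of_globalAction : deligne1982_weilFamily_globalAction → ∀ p : ℕ, p.Prime → p % 4 = 3 → 7 ≤ p → ∀ (k : ℕ), 1 ≤ k → ∀ (X : AbelianVariety ℂ) (Φ : X ⟶ X), X.dim = 2 * k → Φ ≫ Φ = -((p : ℤ) • 𝟙 X) → ∀ c : complexBetti X.X (2 * k), c ∈ weilClassesOf X Φ k p → c ≠ 0 → IsRationalClass c → IsOfHodgeType (2 * k) X.X (2 * k) k k c → ∃ (𝒳 S : SchemeOver ℂ) (f : 𝒳 ⟶ S) (g : 𝒳 ⟶ 𝒳) (s₁ s₀ : ComplexPoints S) (e : X.X ≅ fiberOver f s₁) (σ : ComplexPoints S → FiberClass f (2 * k)), IsSmoothProjectiveFamily f (2 * k) ∧ (∃ (N : ℕ) (ι : 𝒳 ⟶ projectiveSpace N ℂ ⊗ S), IsClosedImmersion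 ι.left ∧ ι ≫ snd (projectiveSpace N ℂ) S = f) ∧ IrreducibleSpace S.left ∧ AlgebraicGeometry.Smooth S.hom ∧ IsQuasiProjectiveOver S ∧ g ≫ f = f ∧ (∀ s : ComplexPoints S, ∃ (A' : AbelianVariety ℂ) (φ' : A' ⟶ A') (e' : A'.X ≅ fiberOver f s), A'.dim = 2 * k ∧ φ' ≫ φ' = -((p : ℤ) • 𝟙 A') ∧ (e'.hom ≫ fiberι f s) ≫ g = φ'.hom.hom.hom ≫ (e'.hom ≫ fiberι f s)) ∧ (e.hom ≫ fiberι f s₁) ≫ g = Φ.hom.hom.hom ≫ (e.hom ≫ fiberι f s₁) ∧ Continuous σ ∧ (∀ s, (σ s).pt = s) ∧ (∀ s, IsOfHodgeType (2 * k) (fiberOver f (σ s).pt) (2 * k) k k (σ s).cls) ∧ σ s₁ = ⟨s₁, complexBetti.map e.inv (2 * k) c⟩ ∧ ∃ (Y : AbelianVariety ℂ) (Ψ : Y ⟶ Y) (e₀ : Y.X ≅ fiberOver f s₀) (x : complexBetti (fiberOver f s₀) (2 * k)), (∃ (A₁ : AbelianVariety ℂ) (f₁ : Y ⟶ A₁.prod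 A₁) (g₁ : A₁.prod A₁ ⟶ Y) (m : ℕ), A₁.dim = k ∧ Y.dim = 2 * k ∧ Ψ ≫ Ψ = -((p : ℤ) • 𝟙 Y) ∧ 0 < m ∧ f₁ ≫ g₁ = m • 𝟙 Y ∧ Flat f₁.hom.hom.hom.left ∧ g₁ ≫ Ψ = AbelianVariety.prodLift (AbelianVariety.snd A₁ A₁ ≫ (-((p : ℤ) • 𝟙 A₁))) (AbelianVariety.fst A₁ A₁) ≫ g₁) ∧ (e₀.hom ≫ fiberι f s₀) ≫ g = Ψ.hom.hom.hom ≫ (e₀.hom ≫ fiberι f s₀) ∧ σ s₀ = ⟨s₀, x⟩ ∧ complexBetti.map e₀.hom (2 * k) x ∈ weilClassesOf Y Ψ k p := by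
  intro h p hp hp4 hp7 k hk X Φ hX hΦ c hc hc0 hrat hH
  obtain ⟨𝒳, S, f, g, s₁, s₀, e, σ, hfam, hemb, hirr, hsm, hSqp, hg, hfib, he, hσ, hpt, hσ₁, Y, Ψ,
    e₀, hiso, he₀⟩ := h p hp hp4 hp7 k hk X Φ hX hΦ c hc hc0 hrat hH
  have hp0 : 0 < p := hp.pos
  -- the base: `S(ℂ)` is a path-connected manifold and `R^{2k} f_* ℂ` is a local system on it
  haveI := hsm
  haveI := hirr
  haveI : LocallyOfFiniteType S.hom := hSqp.locallyOfFiniteType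
  haveI : ConnectedSpace (ComplexPoints S) :=
    (Motives.ComplexPoints.connectedSpace_iff_holds S).2 inferInstance
  obtain ⟨d, hd⟩ := exists_smoothOfRelativeDimension_of_connectedSpace_complexPoints S
  haveI := hd
  haveI := pathConnectedSpace_complexPoints_of_smoothOfRelativeDimension S d
  have hU := isCohomologicallyLocallyTrivialOn_univ_of_isSmoothProjectiveFamily f d hfam hSqp
  -- the fibre maps of `g`
  have hgf' := fun t ↦ exists_fiberHom_comp_fiberι f g hg t
  choose gf hgf using hgf'
  -- the cohomological Weil plane of the fibre over `t`
  let WP : ∀ t : ComplexPoints S, Submodule ℂ (complexBetti (fiberOver f t) (2 * k)) :=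
    fun t ↦
      Submodule.span ℂ
        {x | ∃ w : Fin (2 * k) → complexBetti (fiberOver f t) 1,
          (∀ i, w i ∈ Module.End.eigenspace (complexBetti.map (gf t) 1).hom
            (Complex.I * (Real.sqrt p : ℂ))) ∧
          cupPowOne ℂ (ComplexPoints (fiberOver f t)) (2 * k) w = x} ⊔
      Submodule.span ℂ
        {x | ∃ w : Fin (2 * k) → complexBetti (fiberOver f t) 1,
          (∀ i, w i ∈ Module.End.eigenspace (complexBetti.map (gf t) 1).hom
            (-(Complex.I * (Real.sqrt p : ℂ)))) ∧
          cupPowOne ℂ (ComplexPoints (fiberOver f t)) (2 * k) w = x}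
  -- at `s₁`: `e^{-1 *} c` lies in the Weil plane of `(𝒳_{s₁}, g_{s₁})`
  have hΦ' : Φ ≫ Φ = -(p • 𝟙 X) := by rw [hΦ, natCast_zsmul]
  have he' : e.hom ≫ gf s₁ = Φ.hom.hom.hom ≫ e.hom :=
    hom_comp_fiberHom_eq_of_comp_fiberι f g (hgf s₁) e Φ.hom.hom.hom he
  have h₁ : complexBetti.map e.inv (2 * k) c ∈ WP s₁ :=
    map_inv_mem_eigenLines_of_mem_weilClassesOf e (gf s₁) hp0 hX hΦ' he' hc
  -- transport from `s₁`: every value of `σ` lies in the Weil plane of its fibre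
  have key : ∀ (s t : ComplexPoints S) (hst : (σ s).pt = t), (σ s).clsAt hst ∈ WP t := by
    intro s t hst
    obtain rfl : s = t := (hpt s).symm.trans hst
    let γ : Path (⟨s₁, Set.mem_univ s₁⟩ : (Set.univ : Set (ComplexPoints S))) ⟨s, Set.mem_univ s⟩ :=
      (PathConnectedSpace.somePath s₁ s).map (continuous_id.subtype_mk _)
    have htr := transportFun_clsAt_of_continuous f (2 * k) hU hσ hpt γ
    have h0 : (σ s₁).clsAt (hpt s₁) = complexBetti.map e.inv (2 * k) c := by
      rw [FiberClass.clsAt_eq_iff]; exact hσ₁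
    change transportFun f (2 * k) hU ⟦γ⟧ ((σ s₁).clsAt (hpt s₁)) = (σ s).clsAt (hpt s) at htr
    rw [← htr, h0]
    exact transportFun_mem_eigenLines f hU g hg gf hgf ⟦γ⟧ _ _ (2 * k) h₁
  refine ⟨𝒳, S, f, g, s₁, s₀, e, σ, hfam, hemb, hirr, hsm, hSqp, hg, fun s ↦ ?_, he, hσ, hpt, fun s ↦ ?_,
    hσ₁, Y, Ψ, e₀, (σ s₀).clsAt (hpt s₀), hiso, he₀, (FiberClass.mk_clsAt _ _).symm, ?_⟩
  · -- every fibre is an abelian `2k`-fold with `√-p`, charts intertwining `g`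
    obtain ⟨A', φ', e', hA', hφ', he'c, -⟩ := hfib s
    exact ⟨A', φ', e', hA', hφ', he'c⟩
  · -- the values of `σ` are of Hodge type `(k,k)`: read in the chart of clause (a)
    obtain ⟨A', φ', e', hA', hφ', he'c, hbal⟩ := hfib (σ s).pt
    have hmem : (σ s).cls ∈ WP (σ s).pt := key s (σ s).pt rfl
    have he'' : e'.hom ≫ gf (σ s).pt = φ'.hom.hom.hom ≫ e'.hom :=
      hom_comp_fiberHom_eq_of_comp_fiberι f g (hgf _) e' φ'.hom.hom.hom he'c
    have hA'mem : complexBetti.map e'.hom (2 * k) (σ s).cls ∈ weilClassesOf A' φ' k p :=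
      map_mem_weilClassesOf_of_mem_eigenLines e' (gf _) he'' hmem
    have htyp := (hbal _ hA'mem).map_of_iso e'.symm
    have hid : singularCohomology.map ℂ ℂ (Motives.AlgPoints.mapContinuous (L := ℂ) e'.symm.hom) (2 * k)
        (complexBetti.map e'.hom (2 * k) (σ s).cls) = (σ s).cls := by
      change complexBetti.map e'.inv (2 * k) (complexBetti.map e'.hom (2 * k) (σ s).cls) = _
      rw [← ModuleCat.comp_apply, ← complexBetti.map_comp, e'.inv_hom_id, complexBetti.map_id]
      rfl
    rw [hid] at htyp
    exact htyp
  · -- at `s₀`: the value lies in the strong Weil plane of `(Y, Ψ)`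
    have he₀' : e₀.hom ≫ gf s₀ = Ψ.hom.hom.hom ≫ e₀.hom :=
      hom_comp_fiberHom_eq_of_comp_fiberι f g (hgf s₀) e₀ Ψ.hom.hom.hom he₀
    exact map_mem_weilClassesOf_of_mem_eigenLines e₀ (gf s₀) he₀' (key s₀ s₀ (hpt s₀))


end Summit.HodgeConjecture.HodgeConjecture.Theorems.WeilTenfoldsSqrtMinus11.TensorAnchorPerryPol

end
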